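import Summits.ABC.IUTFork.Conditional.RefBandsInhTypeBandsMB
import Summits.ABC.IUTFork.Conditional.RefBandsInhTypeBandIsSquare2707160810382798173125
import HarnessLib

/-!
# Branch C / R-W, reading (U), M line: the M-SETTING twin of the R-W lane's IsSquare model-clause INH theorem
# `5 ^ 4 * 19 ^ 13 * 103 + 2 ^ 13 * 13 ^ 9 * 29 * 2441 * 7673 ^ 2 = 3 ^ 19 * 11 ^ 4 * 463 ^ 5` — `√λ ∈ F` ⇒ the M books' (U) binder INHABITED AS TYPED, EVERY prime `l ≥ 2822723`
# (abc-iut cell, branch C, row «C:INH-M-TWIN-RESIDUE» item (b); seat abc-iut-C-cert-2 gen 8; C LEAD KEY 2026-08-27T13:11Z)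

Record-only PROOF file (D-0012; 0 definitions, 0 `Prop` facts, nothing re-typed) of the abc-iut cell. TAKES NO SIDE on [IUTchIII] Cor. 3.12
(S. Mochizuki, *Inter-universal Teichmüller theory III*, Cor. 3.12 p. 173–174; Step (xi-f) p. 184) or on any author; «inhabited as typed» ≠
«asserted in print».

THE K THEOREM THAT CARRIES THE `IsSquare` HYPOTHESIS is abc-iut-W-num-6's `WRow.licence_triple_2707160810382798173125_typeband_of_isSquare`
(`RefBandsInhTypeBandIsSquare2707160810382798173125` p511689): it is the INH-type half-axis `WRow.licence_triple_2707160810382798173125_typeband_e30`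
(`l ≥ 2822723`, hook `e(·|19) = 30·l`) with the hook DISCHARGED from the model clause `hsq : IsSquare (algebraMap F‡ T.F λ)` by abc-iut-W-neg-2's exact
tame type `GenuineK.absRamificationIdx_kOf_eq_thirty_mul_of_isSquare` (pole `19 ∥^13 a`, `RefBand.ord_lam_2707160810382798173125_p19`,
`RadTriple.ord_jInv_eq_neg_two_mul`). The hook lives ON THE K SIDE, and so does `hsq` (a statement about `T.F`); this seat's gen-7 M twin of the type
half-axis `WRowM.licence_triple_2707160810382798173125_typeband_e30_M` (`RefBandsInhTypeBandsMB` p532226) takes the SAME `hloc` — so the M twin of the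
IsSquare theorem is that M type twin with the K file's `hloc` discharge COPIED VERBATIM (hypothesis `hsq` VERBATIM).

* **`WRowM.licence_triple_2707160810382798173125_typeband_of_isSquare_M`** — `hsq` ⇒ `Thm311ToCor312.Licence` at the M-LEVEL setting of the datum's own
  ideles `settingPrVolSharpM T.D hlog (tOfIdeleData T.D r) (tqM … r …) …` for EVERY idele datum `r`, every analytic `logvK`, any `htq0/Sq/htq1`,
  EVERY prime `l ≥ 2822723`.

HONEST SCOPE: a statement under the model clause `hsq`; OUR sharp containers and Dupuy–Hilado's typed (Ind1)/(Ind2); STRONGER-THAN-PRINT hull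
reading; a socket discharges nothing; non-emptiness of the datum type, admissibility and Szpiro-badness NOT claimed; explicit hypothesis counts of
the record books UNCHANGED; an M twin changes NO K-line census count; nothing about the printed GLOBAL inequality or the number-level corollary;
typed ≠ proved; instantiated ≠ endorsed; no abc claim. [cite: Mochizuki2012, IUTchI Def. 3.1 (b),(c) pp. 61–62, Ex. 3.2 (iv) p. 71; IUTchIII
Cor. 3.12 Step (xi-f) p. 184; IUTchIV Thm. 1.10 p. 22, Prop. 1.2 (i)(ii) p. 10, Prop. 1.4 (ii) p. 13, Cor. 2.2 (ii) proof (P5) p. 46]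
[cite: DupuyHilado2025, §3.3, §3.4, §4.9, §4.12] [cite: SilvermanAEC2009, Prop. III.1.7(b)] [claim: Mochizuki2012, status: disputed] for every IUT
sentence. PROOF-ONLY: no definitions.
-/

noncomputable section

open Set Function Metric NumberField IsDedekindDomain

namespace Summit.ABC.IUTFork.Conditional

open Thm311 Thm311.Real Cor312 Cor312Vol Cor312Prov Literature.IUT.LogThetaLattice Literature.IUT.LogVolume
  Literature.IUT.HodgeTheaters Literature.IUT.LogVolume.Cor22
open Literature.NumberTheory.NumberFields Literature.NumberTheory.GaloisRepresentations.Ultrametric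
open Literature.NumberTheory.DiophantineGeometry Literature.NumberTheory.DiophantineGeometry.GenEll

/-- **M TWIN of `WRow.licence_triple_2707160810382798173125_typeband_of_isSquare`**: `5 ^ 4 * 19 ^ 13 * 103 + 2 ^ 13 * 13 ^ 9 * 29 * 2441 * 7673 ^ 2 = 3 ^ 19 * 11 ^ 4 * 463 ^ 5`,
EVERY prime `l ≥ 2822723`, EVERY genuine Θ-volume datum `T` over the Frey point whose field `T.F` contains `√λ` (`hsq`, VERBATIM the K theorem's), EVERY
idele datum `r` of `T.D` ⇒ `Thm311ToCor312.Licence` at the M-LEVEL setting `settingPrVolSharpM T.D hlog (tOfIdeleData T.D r) (tqM … r …) …` — gen 7's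
M type twin `WRowM.licence_triple_2707160810382798173125_typeband_e30_M` with the K file's hook discharge (`GenuineK.absRamificationIdx_kOf_eq_thirty_mul_of_isSquare`
at the odd pole `19`) COPIED VERBATIM. The M books' (U) binder is INHABITED AS TYPED there, under the model clause.
[cite: Mochizuki2012, IUTchIII Cor. 3.12 Step (xi-f) p. 184; IUTchIV Thm. 1.10 p. 22, Prop. 1.2 (i)(ii) p. 10, Cor. 2.2 (ii) proof (P5) p. 46]
[cite: DupuyHilado2025, §3.3, §3.4, §4.9, §4.12] [claim: Mochizuki2012, status: disputed] -/
theorem WRowM.licence_triple_2707160810382798173125_typeband_of_isSquare_M {l : ℕ} (hl : l.Prime) (hl0 : 2822723 ≤ l)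
    (T : Cor22.ThetaVolumeDatumAt (ratPoint (((5 ^ 4 * 19 ^ 13 * 103 : ℕ) : ℚ) / (3 ^ 19 * 11 ^ 4 * 463 ^ 5 : ℕ))) l)
    (hsq : letI := T.instFieldF; letI := T.instAlgebraF
      IsSquare (algebraMap (ratPoint (((5 ^ 4 * 19 ^ 13 * 103 : ℕ) : ℚ) / (3 ^ 19 * 11 ^ 4 * 463 ^ 5 : ℕ))).F T.F
        ((((5 ^ 4 * 19 ^ 13 * 103 : ℕ) : ℚ) / (3 ^ 19 * 11 ^ 4 * 463 ^ 5 : ℕ)) : ℚ))) :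
    letI := T.instFieldF; letI := T.instNumberFieldF; letI := T.instAlgebraF; letI := T.instFieldK
    letI := T.instNumberFieldK; letI := T.instAlgebraK; letI := T.instFieldFbar; letI := T.instAlgebraFbar
    letI := T.instAlgebraKFbar; letI := T.instIsElliptic
    ∀ {logvK : PadicLogsVal T.K} (hlog : LogvAnalyticVal logvK) (r : ThetaData.IdeleData T.D) (M : Type) [Field M] [NumberField M]
      (archPk : ∀ (j : (thetaIndexOfInitial T.D).Label) (vQ : (thetaIndexOfInitial T.D).VQ),
        Set ((logShellsOfInitialDH T.D logvK).Packet j vQ))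
      (archSub : ∀ (j : (thetaIndexOfInitial T.D).Label) (v : (thetaIndexOfInitial T.D).V),
        Set ((logShellsOfInitialDH T.D logvK).Packet j ((thetaIndexOfInitial T.D).over v)))
      (Ψ : ℤ → ∀ v : (thetaIndexOfInitial T.D).V, v ∈ (thetaIndexOfInitial T.D).Vbad →
        Set ((logShellsOfInitialDH T.D logvK).StarPacket v))
      (act : ℤ → ∀ v : (thetaIndexOfInitial T.D).V, v ∈ (thetaIndexOfInitial T.D).Vbad →
        (logShellsOfInitialDH T.D logvK).StarPacket v → Module.End ℚ ((logShellsOfInitialDH T.D logvK).StarPacket v))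
      (Mmod : ℤ → ∀ j : (thetaIndexOfInitial T.D).LabelStar, Set ((logShellsOfInitialDH T.D logvK).GlobalPacket j.1))
      (region : ℤ → ∀ j : (thetaIndexOfInitial T.D).LabelStar, FinDivisor M → ∀ vQ : (thetaIndexOfInitial T.D).VQ,
        Set ((logShellsOfInitialDH T.D logvK).Packet j.1 vQ))
      (n : ℤ) {HT : Type} {LogLink : HT → HT → Type} {IsFull : ∀ {s t : HT}, LogLink s t → Prop}
      (lat : LGPGaussianLogThetaLattice LogLink IsFull)
      {Frd : Type} {IsoF : Frd → Frd → Type} {Ob : Frd → Type} {realify : Frd → Frd} {Strip : Type}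
      {IsoS : Strip → Strip → Type}
      {Mv : ∀ v : (thetaIndexOfInitial T.D).V, v ∈ (thetaIndexOfInitial T.D).Vbad → Type} [∀ v h, Monoid (Mv v h)]
      (sig : GlobalLGPFrobenioidSignature (thetaIndexOfInitial T.D).lstar (thetaIndexOfInitial T.D).V
        (· ∈ (thetaIndexOfInitial T.D).Vbad) Frd IsoF Ob realify Strip IsoS Mv)
      (split : SplittingMonoids Mv) {ObΔ : Type}
      {N : ∀ v : (thetaIndexOfInitial T.D).V, v ∈ (thetaIndexOfInitial T.D).Vbad → Type} [∀ v h, Monoid (N v h)]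
      (qData : QPilotData ObΔ N)
      (htq0 : ∀ (u : FinitePlace ℚ) (x : (thetaIndexOfInitial T.D).Fibre (Val.non u)),
        tqM T.D (ratChar u) u (natCast_ratChar_mem u) r x ≠ 0)
      (Sq : Finset (FinitePlace ℚ))
      (htq1 : ∀ (u : FinitePlace ℚ) (x : (thetaIndexOfInitial T.D).Fibre (Val.non u)), u ∉ Sq →
        ‖tqM T.D (ratChar u) u (natCast_ratChar_mem u) r x‖ = 1),
      Thm311ToCor312.Licence
        (settingPrVolSharpM T.D hlog (tOfIdeleData T.D r) (fun u x => tqM T.D (ratChar u) u (natCast_ratChar_mem u) r x) M archPk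
          archSub Ψ act Mmod region n lat sig split qData htq0 Sq htq1) := by
  refine WRowM.licence_triple_2707160810382798173125_typeband_e30_M hl hl0 T fun x₀ => ?_
  have hp : Nat.Prime 19 := by norm_num
  have hpole : ∀ u : HeightOneSpectrum (𝓞 ℚ), Rat.HeightOneSpectrum.natGenerator u = ((⟨19, hp⟩ : Nat.Primes) : ℕ) →
      ord ℚ u (jInv (((5 ^ 4 * 19 ^ 13 * 103 : ℕ) : ℚ) / (3 ^ 19 * 11 ^ 4 * 463 ^ 5 : ℕ))) = -(2 * ((13 : ℕ) : ℤ)) := fun u hu =>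
    RadTriple.ord_jInv_eq_neg_two_mul (p := 19) (v := 13) isABCTriple_463 hp (by norm_num) (by norm_num) (by norm_num) (by norm_num) u hu
  exact GenuineK.absRamificationIdx_kOf_eq_thirty_mul_of_isSquare T ⟨19, hp⟩ (by norm_num) (by norm_num) (by norm_num)
    (show ((⟨19, hp⟩ : Nat.Primes) : ℕ) ≠ l by simp; omega) (by norm_num) hpole (by norm_num) hsq (RefBand.ord_lam_2707160810382798173125_p19) x₀

end Summit.ABC.IUTFork.Conditional

end
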